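import Summits.BirchSwinnertonDyer.BirchSwinnertonDyer.Theorems.SignedLowerHalvesSmallImageLowerHalfBothSignsRttD2SeqSemilocData
import Mathlib.Order.KonigLemma
import HarnessLib

/-!
# Route `SignedLowerHalves`, crux L `SmallImageLowerHalfBothSigns` (stmt-BirchSwinnertonDyer-23599), line `rtt_w3` v30 — stub S3β″ (`stub_junctionPT_ns`), input N5-(i)
# (finiteness of the semilocal Iwasawa modules), part 1: KŐNIG FOR DOUBLE TOWERS AND FOR THE SEMILOCAL IWASAWA DATA —
# transition-closed level sets with finite levels and non-empty diagonal are met by the projections of ONE element of `𝐇^i_{Iw,w}`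

WIDTH seat `bsd-line-slh-p3-w3` g26 under LEAD `cruxlead-stmt-BirchSwinnertonDyer-23599` g14 (cell `bsd-ssimc`); helper `--supports stmt-BirchSwinnertonDyer-23599`
(design memo `Lines/rtt_w3-DESIGN-S3beta-w3-g25.md`, rev 4 §6, RECIPE N5: `hfin/htors` for `Π_w L_w.H` by the compact-Nakayama pattern). DEFINITIONS WITH BODIES (`fstLE`, `sndLE`,
`diagStep`, `diagLE` — iterated transition maps of a double tower, all `downLE` of g22's `…RttD2SeqJ3Transitions`) + THEOREMS; no named fact, no instance, no `sorry`.
HONEST FRAMING: pure bookkeeping (the GENERIC form of the Kőnig step cloned three times in the tree: g22 `…RttD2SeqJ3Konig`, honda `…RttD2J2DeltaExact`, `…RttJunctionShaSp2Injective`),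
written once for ANY double tower of abelian groups and specialised to -w3's semilocal data `SemilocIwasawaCohomologyDataO` (pin (P4)); it is the compactness engine of part 2
(`…RttD2SeqSemilocNakayama`: `p`-divisibility lifts along the tower ⟹ `𝐇^i_{Iw,w}` finitely generated). Nothing about S3β″, crux L or BSD is proved; all remain OPEN, for NO curve.

* §1 (generic double towers `G n k`, one-step maps `c n k : G (n+1) k → G n k`, `r n k : G n (k+1) → G n k`) `fstLE`/`sndLE`/`diagStep`/`diagLE`, their calculus, ★ `diagLE_eq`
  (the iterated diagonal transition is `fstLE ∘ sndLE` when `c ∘ r = r ∘ c`), closure of transition-closed sets under the iterated maps.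
* §2 ★★ `exists_compatible_family_of_forall_nonempty` — GENERIC KŐNIG: finite levels, `A n k` closed under `c` and `r`, every `A m m ≠ ∅` ⟹ a `c`/`r`-compatible family `y` with
  `y n k ∈ A n k` for all `n, k` (Mathlib `exists_seq_forall_proj_of_forall_finite` on the diagonal, then spreading by `fstLE ∘ sndLE`).
* §3 ★★ `SemilocIwasawaCohomologyDataO.exists_proj_mem_of_forall_nonempty` — for -w3's semilocal data (any degree `i`, any place `w`): some `x ∈ L.H` has ALL
  `proj_{n,k} x ∈ A n k` (§2 + (P4) `proj_surjective`; `cor ∘ red = red ∘ cor` is T1-b₁ `semilocCores_semilocCoeff`).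
References: [NeukirchSchmidtWingberg2008] I §5 (1.5.1)–(1.5.2), (8.6.2)–(8.6.3); [Rubin2000] Prop. B.1.1; [MilneADT2006] I Thm. 4.10; D. Kőnig (1936) §6 (Mathlib `Order.KonigLemma`).
-/

set_option autoImplicit false
set_option linter.dupNamespace false -- D-0017: single-problem summit, the namespace repeats the problem name by design
noncomputable section

open scoped Classical
open NumberField IsDedekindDomain Field

namespace Summit.BirchSwinnertonDyer.BirchSwinnertonDyer.Theorems.SmallImageRttD2Seq

open Literature.NumberTheory.EllipticCurves Literature.NumberTheory.GaloisRepresentations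

/-! ## §1. Iterated transitions of a double tower -/

section Generic

universe w

variable {G : ℕ → ℕ → Type w} [∀ n k, AddCommGroup (G n k)]
  (c : ∀ n k : ℕ, G (n + 1) k →+ G n k) (r : ∀ n k : ℕ, G n (k + 1) →+ G n k)

/-- **Iterated first-index transition `G n′ k → G n k` (`n ≤ n′`)** (`downLE` of the one-step maps `c · k`). [cite: NeukirchSchmidtWingberg2008, I §5 Prop. 1.5.2] -/
def fstLE {n n' : ℕ} (h : n ≤ n') (k : ℕ) : G n' k →+ G n k :=
  downLE (G := fun j ↦ G j k) (fun j ↦ c j k) h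

/-- **Iterated second-index transition `G n k′ → G n k` (`k ≤ k′`)** (`downLE` of the one-step maps `r n ·`). [cite: NeukirchSchmidtWingberg2008, I §5 Prop. 1.5.2] -/
def sndLE (n : ℕ) {k k' : ℕ} (h : k ≤ k') : G n k' →+ G n k :=
  downLE (G := fun j ↦ G n j) (fun j ↦ r n j) h

/-- **The diagonal one-step map `G (m+1) (m+1) → G m m`** (`c ∘ r`). [cite: NeukirchSchmidtWingberg2008, I §5 (1.5.1)] -/
def diagStep (m : ℕ) : G (m + 1) (m + 1) →+ G m m :=
  (c m m).comp (r (m + 1) m)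

/-- **Iterated diagonal transition `G m′ m′ → G m m` (`m ≤ m′`)**. [cite: NeukirchSchmidtWingberg2008, I §5 (1.5.1)] -/
def diagLE {m m' : ℕ} (h : m ≤ m') : G m' m' →+ G m m :=
  downLE (G := fun j ↦ G j j) (diagStep c r) h

omit r in
/-- `fstLE` along `n ≤ n` is the identity. [folklore] -/
theorem fstLE_refl (n k : ℕ) (y : G n k) : fstLE c (le_refl n) k y = y :=
  downLE_refl (G := fun j ↦ G j k) _ n y

omit r in
/-- `fstLE` is transitive. [folklore] -/
theorem fstLE_trans {n n' n'' : ℕ} (h : n ≤ n') (h' : n' ≤ n'') (k : ℕ) (y : G n'' k) :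
    fstLE c h k (fstLE c h' k y) = fstLE c (h.trans h') k y :=
  downLE_trans (G := fun j ↦ G j k) _ h h' y

omit r in
/-- `fstLE` along `n ≤ n + 1` is the one-step map. [folklore] -/
theorem fstLE_one (n k : ℕ) (y : G (n + 1) k) : fstLE c (Nat.le_succ n) k y = c n k y :=
  downLE_one (G := fun j ↦ G j k) _ n y

omit r in
/-- Peeling `fstLE` at the top. [folklore] -/
theorem fstLE_succ {n n' : ℕ} (h : n ≤ n') (h' : n ≤ n' + 1) (k : ℕ) (y : G (n' + 1) k) : fstLE c h' k y = fstLE c h k (c n' k y) :=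
  downLE_succ (G := fun j ↦ G j k) _ h h' y

omit r in
/-- Peeling `fstLE` at the bottom. [folklore] -/
theorem apply_fstLE_succ {n n' : ℕ} (h : n + 1 ≤ n') (k : ℕ) (y : G n' k) : c n k (fstLE c h k y) = fstLE c ((Nat.le_succ n).trans h) k y := by
  rw [← fstLE_one c n k, fstLE_trans]

omit c in
/-- `sndLE` along `k ≤ k` is the identity. [folklore] -/
theorem sndLE_refl (n k : ℕ) (y : G n k) : sndLE r n (le_refl k) y = y :=
  downLE_refl (G := fun j ↦ G n j) _ k y

omit c in
/-- `sndLE` is transitive. [folklore] -/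
theorem sndLE_trans (n : ℕ) {k k' k'' : ℕ} (h : k ≤ k') (h' : k' ≤ k'') (y : G n k'') :
    sndLE r n h (sndLE r n h' y) = sndLE r n (h.trans h') y :=
  downLE_trans (G := fun j ↦ G n j) _ h h' y

omit c in
/-- `sndLE` along `k ≤ k + 1` is the one-step map. [folklore] -/
theorem sndLE_one (n k : ℕ) (y : G n (k + 1)) : sndLE r n (Nat.le_succ k) y = r n k y :=
  downLE_one (G := fun j ↦ G n j) _ k y

omit c in
/-- Peeling `sndLE` at the top. [folklore] -/
theorem sndLE_succ (n : ℕ) {k k' : ℕ} (h : k ≤ k') (h' : k ≤ k' + 1) (y : G n (k' + 1)) : sndLE r n h' y = sndLE r n h (r n k' y) :=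
  downLE_succ (G := fun j ↦ G n j) _ h h' y

omit c in
/-- Peeling `sndLE` at the bottom. [folklore] -/
theorem apply_sndLE_succ (n : ℕ) {k k' : ℕ} (h : k + 1 ≤ k') (y : G n k') : r n k (sndLE r n h y) = sndLE r n ((Nat.le_succ k).trans h) y := by
  rw [← sndLE_one r n k, sndLE_trans]

/-- **All first-index transitions commute with all second-index transitions** when the one-step squares commute. [cite: NeukirchSchmidtWingberg2008, I §5 Prop. 1.5.2] -/
theorem fstLE_sndLE (hcr : ∀ (n k : ℕ) (y : G (n + 1) (k + 1)), c n k (r (n + 1) k y) = r n k (c n (k + 1) y))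
    {n n' : ℕ} (h : n ≤ n') {k k' : ℕ} (h' : k ≤ k') (y : G n' k') :
    fstLE c h k (sndLE r n' h' y) = sndLE r n h' (fstLE c h k' y) :=
  downLE_comm c r hcr h h' y

/-- The one-step map `c` commutes with the second-index transitions. [cite: NeukirchSchmidtWingberg2008, I §5 Prop. 1.5.2] -/
theorem apply_sndLE (hcr : ∀ (n k : ℕ) (y : G (n + 1) (k + 1)), c n k (r (n + 1) k y) = r n k (c n (k + 1) y))
    (n : ℕ) {k k' : ℕ} (h : k ≤ k') (y : G (n + 1) k') : c n k (sndLE r (n + 1) h y) = sndLE r n h (c n k' y) :=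
  downLE_map (G := fun j ↦ G (n + 1) j) (G' := fun j ↦ G n j) (fun j ↦ r (n + 1) j) (fun j ↦ r n j) (fun j ↦ c n j) (fun j z ↦ hcr n j z) h y

/-- `diagLE` along `m ≤ m` is the identity. [folklore] -/
theorem diagLE_refl (m : ℕ) (y : G m m) : diagLE c r (le_refl m) y = y :=
  downLE_refl (G := fun j ↦ G j j) _ m y

/-- `diagLE` is transitive. [folklore] -/
theorem diagLE_trans {m m' m'' : ℕ} (h : m ≤ m') (h' : m' ≤ m'') (y : G m'' m'') : diagLE c r h (diagLE c r h' y) = diagLE c r (h.trans h') y :=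
  downLE_trans (G := fun j ↦ G j j) _ h h' y

/-- Peeling `diagLE` at the top. [folklore] -/
theorem diagLE_succ {m m' : ℕ} (h : m ≤ m') (h' : m ≤ m' + 1) (y : G (m' + 1) (m' + 1)) : diagLE c r h' y = diagLE c r h (c m' m' (r (m' + 1) m' y)) :=
  downLE_succ (G := fun j ↦ G j j) _ h h' y

/-- ★ **The iterated diagonal transition is `fstLE ∘ sndLE`** (commuting squares). [cite: NeukirchSchmidtWingberg2008, I §5 (1.5.1)] -/
theorem diagLE_eq (hcr : ∀ (n k : ℕ) (y : G (n + 1) (k + 1)), c n k (r (n + 1) k y) = r n k (c n (k + 1) y))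
    {m m' : ℕ} (h : m ≤ m') (y : G m' m') : diagLE c r h y = fstLE c h m (sndLE r m' h y) := by
  induction m', h using Nat.le_induction with
  | base => rw [diagLE_refl, fstLE_refl, sndLE_refl]
  | succ m' h ih =>
    rw [diagLE_succ c r h, ih, fstLE_succ c h, sndLE_succ r (m' + 1) h, apply_sndLE c r hcr]

variable {c r}

omit r in
/-- Sets closed under `c` are closed under `fstLE`. [folklore] -/
theorem fstLE_mem {A : ∀ n k : ℕ, Set (G n k)} (hAc : ∀ (n k : ℕ) (y : G (n + 1) k), y ∈ A (n + 1) k → c n k y ∈ A n k)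
    {n n' : ℕ} (h : n ≤ n') (k : ℕ) {y : G n' k} (hy : y ∈ A n' k) : fstLE c h k y ∈ A n k := by
  induction n', h using Nat.le_induction with
  | base => rwa [fstLE_refl]
  | succ n' h ih => rw [fstLE_succ c h]; exact ih (hAc n' k y hy)

omit c in
/-- Sets closed under `r` are closed under `sndLE`. [folklore] -/
theorem sndLE_mem {A : ∀ n k : ℕ, Set (G n k)} (hAr : ∀ (n k : ℕ) (y : G n (k + 1)), y ∈ A n (k + 1) → r n k y ∈ A n k)
    (n : ℕ) {k k' : ℕ} (h : k ≤ k') {y : G n k'} (hy : y ∈ A n k') : sndLE r n h y ∈ A n k := by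
  induction k', h using Nat.le_induction with
  | base => rwa [sndLE_refl]
  | succ k' h ih => rw [sndLE_succ r n h]; exact ih (hAr n k' y hy)

/-- Sets closed under `c` and `r` are closed under `diagLE`. [folklore] -/
theorem diagLE_mem {A : ∀ n k : ℕ, Set (G n k)} (hAc : ∀ (n k : ℕ) (y : G (n + 1) k), y ∈ A (n + 1) k → c n k y ∈ A n k)
    (hAr : ∀ (n k : ℕ) (y : G n (k + 1)), y ∈ A n (k + 1) → r n k y ∈ A n k)
    {m m' : ℕ} (h : m ≤ m') {y : G m' m'} (hy : y ∈ A m' m') : diagLE c r h y ∈ A m m := by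
  induction m', h using Nat.le_induction with
  | base => rwa [diagLE_refl]
  | succ m' h ih => rw [diagLE_succ c r h]; exact ih (hAc m' m' _ (hAr (m' + 1) m' y hy))

/-! ## §2. Kőnig for double towers -/

variable (c r)

/-- ★★ **KŐNIG FOR A DOUBLE TOWER.** Finite levels `G n k`, commuting one-step maps, level sets `A n k` closed under both one-step maps with every diagonal set `A m m` non-empty ⟹
there is a `c`/`r`-COMPATIBLE family `y` with `y n k ∈ A n k` for all `n, k` (Kőnig on the diagonal system `(A m m, c ∘ r)`, then `y n k := fstLE (sndLE (s (max n k)))`).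
[cite: NeukirchSchmidtWingberg2008, I §5 (1.5.1)] [cite: Rubin2000, Prop. B.1.1] [cite: MilneADT2006, I Thm. 4.10] -/
theorem exists_compatible_family_of_forall_nonempty (hcr : ∀ (n k : ℕ) (y : G (n + 1) (k + 1)), c n k (r (n + 1) k y) = r n k (c n (k + 1) y))
    (hfin : ∀ n k : ℕ, Finite (G n k)) (A : ∀ n k : ℕ, Set (G n k))
    (hAc : ∀ (n k : ℕ) (y : G (n + 1) k), y ∈ A (n + 1) k → c n k y ∈ A n k) (hAr : ∀ (n k : ℕ) (y : G n (k + 1)), y ∈ A n (k + 1) → r n k y ∈ A n k)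
    (hne : ∀ m : ℕ, (A m m).Nonempty) :
    ∃ y : ∀ n k : ℕ, G n k, (∀ n k, c n k (y (n + 1) k) = y n k) ∧ (∀ n k, r n k (y n (k + 1)) = y n k) ∧ ∀ n k, y n k ∈ A n k := by
  haveI : ∀ m : ℕ, Finite {z // z ∈ A m m} := fun m ↦ by haveI := hfin m m; exact Subtype.finite
  haveI : ∀ m : ℕ, Nonempty {z // z ∈ A m m} := fun m ↦ (hne m).to_subtype
  obtain ⟨s, hs⟩ := exists_seq_forall_proj_of_forall_finite (α := fun m ↦ {z // z ∈ A m m})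
    (fun {i j} hij z ↦ ⟨diagLE c r hij z.1, diagLE_mem hAc hAr hij z.2⟩) (fun i z ↦ Subtype.ext (diagLE_refl c r _ _))
    (fun i j l hij hjl z ↦ Subtype.ext (diagLE_trans c r hij hjl _)) (fun i z ↦ Set.toFinite _)
  -- values are independent of the diagonal level used
  have hval : ∀ {M M' : ℕ} (hM : M ≤ M') {n k : ℕ} (hn : n ≤ M) (hk : k ≤ M),
      fstLE c hn k (sndLE r M hk (s M).1) = fstLE c (hn.trans hM) k (sndLE r M' (hk.trans hM) (s M').1) := by
    intro M M' hM n k hn hk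
    have h1 : (s M).1 = diagLE c r hM (s M').1 := (congrArg Subtype.val (hs hM)).symm
    rw [h1, diagLE_eq c r hcr hM, ← fstLE_sndLE c r hcr hM hk, sndLE_trans, fstLE_trans]
  refine ⟨fun n k ↦ fstLE c (le_max_left n k) k (sndLE r (max n k) (le_max_right n k) (s (max n k)).1), fun n k ↦ ?_, fun n k ↦ ?_, fun n k ↦ ?_⟩
  · beta_reduce
    rw [apply_fstLE_succ c, hval (max_le_max (Nat.le_succ n) le_rfl) (le_max_left n k) (le_max_right n k)]
  · beta_reduce
    rw [← sndLE_one r n k, ← fstLE_sndLE c r hcr, sndLE_trans, hval (max_le_max le_rfl (Nat.le_succ k)) (le_max_left n k) (le_max_right n k)]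
  · exact fstLE_mem hAc _ k (sndLE_mem hAr _ _ (s (max n k)).2)

end Generic

/-! ## §3. Kőnig for the semilocal Iwasawa data -/

section Semiloc

variable {K : Type} [Field K] [NumberField K] {p : ℕ} [Fact p.Prime] {S : Set (PadicAlgCl p)} {κ : ZpExtension K p} {γ : absoluteGaloisGroup K}
  {θ' : absoluteGaloisGroup K →ₜ* (padicCoeffIntegers S)ˣ} {P : Set (HeightOneSpectrum (𝓞 K))} {w : HeightOneSpectrum (𝓞 K)} {i : ℕ}

variable (S κ θ' P w i) in
/-- `cor ∘ red = red ∘ cor` on the semilocal levels (T1-b₁ `semilocCores_semilocCoeff` at the reduction). [cite: NeukirchSchmidtWingberg2008, I §5 Prop. 1.5.2] -/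
theorem semilocCores_semilocRed (n k : ℕ) (y : semilocCoh S κ θ' P w (n + 1) (k + 1) i) :
    semilocCores S κ θ' P w n k i (semilocRed S κ θ' P w (n + 1) k i y) = semilocRed S κ θ' P w n k i (semilocCores S κ θ' P w n (k + 1) i y) :=
  semilocCores_semilocCoeff S κ θ' P w n _ _ i y

/-- ★★ **KŐNIG FOR `𝐇^i_{Iw,w}`**: for -w3's semilocal Iwasawa data `L` (T1-b₂; any degree, any place), level sets `A n k ⊆ Lloc_w(n,k)` closed under `semilocCores` and `semilocRed`,
finite levels and non-empty diagonal sets `A m m` ⟹ some `x ∈ L.H` has `proj_{n,k} x ∈ A n k` for ALL `(n, k)` (§2 + pin (P4) `proj_surjective`).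
[cite: Rubin2000, Prop. B.1.1] [cite: NeukirchSchmidtWingberg2008, (8.6.2)–(8.6.3)] [cite: MilneADT2006, I Thm. 4.10] -/
theorem SemilocIwasawaCohomologyDataO.exists_proj_mem_of_forall_nonempty (L : SemilocIwasawaCohomologyDataO S κ γ θ' P w i)
    (hfin : ∀ n k : ℕ, Finite (semilocCoh S κ θ' P w n k i)) (A : ∀ n k : ℕ, Set (semilocCoh S κ θ' P w n k i))
    (hAc : ∀ (n k : ℕ) (y : semilocCoh S κ θ' P w (n + 1) k i), y ∈ A (n + 1) k → semilocCores S κ θ' P w n k i y ∈ A n k)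
    (hAr : ∀ (n k : ℕ) (y : semilocCoh S κ θ' P w n (k + 1) i), y ∈ A n (k + 1) → semilocRed S κ θ' P w n k i y ∈ A n k)
    (hne : ∀ m : ℕ, (A m m).Nonempty) : ∃ x : L.H, ∀ n k : ℕ, L.proj n k x ∈ A n k := by
  obtain ⟨y, hyc, hyr, hyA⟩ := exists_compatible_family_of_forall_nonempty (G := fun n k ↦ semilocCoh S κ θ' P w n k i)
    (fun n k ↦ semilocCores S κ θ' P w n k i) (fun n k ↦ semilocRed S κ θ' P w n k i) (semilocCores_semilocRed S κ θ' P w i) hfin A hAc hAr hne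
  obtain ⟨x, hx⟩ := L.proj_surjective y hyc hyr
  exact ⟨x, fun n k ↦ (hx n k).symm ▸ hyA n k⟩

end Semiloc

end Summit.BirchSwinnertonDyer.BirchSwinnertonDyer.Theorems.SmallImageRttD2Seq

end
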